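import Summits.Parity.GeneralizedHardyLittlewood.Theorems.BeyondDiagonalBeatsQuarter.OffDiagCoreWinTaylor
import Summits.Parity.GeneralizedHardyLittlewood.Theorems.BeyondDiagonalBeatsQuarter.OffDiagLevelLargeSieveAggregate
import HarnessLib

/-!
# Route `PrimeLevelFamEdge`, crux K_B (stmt-Parity-20343), line `diagonal_kernel_split` rev 4, plan Ω,
# node **L7d part 2, leaf F2b — the FAMILY bound at one box point: Taylor separation per member (S₅) + the aggregate
# level large sieve (F2a)** (L7D-PLAN rev 6 §6 F2)

Abstract over the member index: a finite family `i ∈ I` with moduli `1 ≤ md i ≤ H ≤ N₀`, unit classes `a i`, complex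
weights `A i`, and member-dependent level-factor parameters `(d₁,d₂,α,β,c,K₁,K₂,X₁,X₂)(i)` whose Taylor radius admits the
block `[t₀, t₀+ℓ]` of reciprocal levels (`ℓ ≤ ρ_i/2`) at the box point `τ ∈ [1/2,2]²` (`t_j(i) = K_j(i)τ_j`); a block `Q` of
prime levels in `(N₀, 2N₀]` with `1/q ∈ [t₀,t₀+ℓ]`; a member-free level weight `g`. Then

  `‖Σ_i A_i·levelLargePart R Q (g·Ψ_{t(i)}(i;1/·)) (md i) (a i)‖
     ≤ (Σ_{j<J} 2^{−j}‖(g·ρ_j)𝟙_Q‖₂)·(Σ_{(h,c)} (Σ_{i→(h,c)} ‖A_i‖)²)^{1/2}·(1+log H)(2(N₀+1)/R + 4H)^{1/2} + J2^{−J}·(Σ_i‖A_i‖)·Σ_{q∈Q}‖g q‖`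

(**`norm_sum_family_levelFactor_le`**), `ρ_j(q) = ((1/q − t₀)/ℓ)^j`: the universal level weights `g·ρ_j` see no member; the
members enter through the ℓ¹-fibres of `‖A_i‖` over (modulus, class) — the flatness/aggregate count of F3.

Pure inequalities; standard axioms. Helper toward `stub_offDiagBelowSlack_io`; closes nothing.
«The programme SEARCHES and TYPES; no claim about Landau–Siegel zeros, Theorems 1–2 of arXiv:2211.02515 or
a repaired Margin232 until a kernel theorem says so.»
-/

noncomputable section

open Finset Real Complex
open scoped Nat

namespace Summit.Parity.GeneralizedHardyLittlewood.Theorems.BeyondDiagonalBeatsQuarter.OffDiag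

open Literature.Analysis.FunctionSpaces (besselJ)
open Literature.NumberTheory.LFunctions.KMV2000 (cutoffW)

/-- ℓ¹-fibres scale: `(Σ_{(h,c)} (Σ_{i→(h,c)} ‖θ·A_i·C_i‖)²)^{1/2} ≤ θ'·(Σ_{(h,c)} (Σ_{i→(h,c)} ‖A_i‖)²)^{1/2}` when
‖C_i‖ ≤ B on the family. [folklore] -/
theorem sqrt_sum_fiber_mul_le {ι : Type*} (fam : Finset ι) (md cl : ι → ℕ) (A C : ι → ℂ) {B : ℝ} (hB : 0 ≤ B)
    (hC : ∀ i ∈ fam, ‖C i‖ ≤ B) (H : ℕ) :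
    Real.sqrt (∑ h ∈ Finset.Icc 1 H, ∑ c ∈ (Finset.range h).filter (fun c ↦ c.Coprime h),
        (∑ i ∈ fam.filter (fun i ↦ md i = h ∧ cl i = c), ‖A i * C i‖) ^ 2) ≤
      B * Real.sqrt (∑ h ∈ Finset.Icc 1 H, ∑ c ∈ (Finset.range h).filter (fun c ↦ c.Coprime h),
        (∑ i ∈ fam.filter (fun i ↦ md i = h ∧ cl i = c), ‖A i‖) ^ 2) := by
  rw [← Real.sqrt_sq hB, ← Real.sqrt_mul (sq_nonneg B), Finset.mul_sum]
  refine Real.sqrt_le_sqrt (Finset.sum_le_sum fun h _ ↦ ?_)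
  rw [Finset.mul_sum]
  refine Finset.sum_le_sum fun c _ ↦ ?_
  rw [← mul_pow, Finset.mul_sum]
  have hle : ∑ i ∈ fam.filter (fun i ↦ md i = h ∧ cl i = c), ‖A i * C i‖ ≤
      ∑ i ∈ fam.filter (fun i ↦ md i = h ∧ cl i = c), B * ‖A i‖ := by
    refine Finset.sum_le_sum fun i hi ↦ ?_
    rw [norm_mul, mul_comm B]
    exact mul_le_mul_of_nonneg_left (hC i (Finset.mem_filter.mp hi).1) (norm_nonneg _)
  exact pow_le_pow_left₀ (Finset.sum_nonneg fun _ _ ↦ norm_nonneg _) hle 2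

/-- **The family bound at one box point.** See the module docstring for the data; `Ψ` is the level factor of
`OffDiagLevelFactorBox` at the member's box point `(K₁(i)τ₁, K₂(i)τ₂)`, `C_j(i)` its Taylor coefficients at `t₀`.
[cite: KowalskiMichelVanderKam2000, §6 p. 19 — derivation; Davenport1980, ch. 29 — derivation] -/
theorem norm_sum_family_levelFactor_le {ι : Type*} (fam : Finset ι) (d₁ d₂ α β c : ι → ℕ) (K₁ K₂ X₁ X₂ : ι → ℝ)
    (hd₁ : ∀ i ∈ fam, 1 ≤ d₁ i) (hd₂ : ∀ i ∈ fam, 1 ≤ d₂ i) (hK₁ : ∀ i ∈ fam, 0 < K₁ i) (hK₂ : ∀ i ∈ fam, 0 < K₂ i)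
    {v₀ t₀ ℓ : ℝ} (hv₀ : 0 < v₀) (hℓ : 0 < ℓ) (ht₀ : v₀ ≤ t₀) (ht₁ : t₀ + ℓ ≤ 2 * v₀)
    (hℓρ : ∀ i ∈ fam, ℓ ≤ v₀ / (1 + 2 * (4 * π * Real.sqrt ((α i : ℝ) * β i * (2 * K₁ i) * (2 * K₂ i)) / c i) * v₀ +
      4 * π * (2 * K₁ i * |X₁ i| + 2 * K₂ i * |X₂ i|) * v₀) / 2)
    {J : ℕ} (hJ : 1 ≤ J) {τ₁ τ₂ : ℝ} (hτ₁ : τ₁ ∈ Set.Icc (1 / 2 : ℝ) 2) (hτ₂ : τ₂ ∈ Set.Icc (1 / 2 : ℝ) 2)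
    {N₀ R H : ℕ} (hR : 1 ≤ R) (Q : Finset ℕ) (hQ : Q ⊆ (Finset.Ioc N₀ (2 * N₀)).filter Nat.Prime) (hH : H ≤ N₀)
    (hQt : ∀ q ∈ Q, ((q : ℝ))⁻¹ ∈ Set.Icc t₀ (t₀ + ℓ)) (g : ℕ → ℂ)
    (md : ι → ℕ) (a : (i : ι) → ZMod (md i)) (hI : ∀ i ∈ fam, md i ∈ Finset.Icc 1 H ∧ IsUnit (a i)) (A : ι → ℂ) :
    ‖∑ i ∈ fam, A i * levelLargePart R Q (fun q ↦ g q *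
        ((cutoffW ((4 * π ^ 2 * ((d₁ i : ℝ) * (K₁ i * τ₁) * ((d₂ i : ℝ) * (K₂ i * τ₂)))) * ((q : ℝ))⁻¹) : ℂ) *
          (besselJ 1 ((4 * π * Real.sqrt ((α i : ℝ) * (K₁ i * τ₁) * ((β i : ℝ) * (K₂ i * τ₂))) / c i) * ((q : ℝ))⁻¹) : ℂ) *
            Complex.exp (((-2 * π * ((K₁ i * τ₁) * X₁ i + (K₂ i * τ₂) * X₂ i) * ((q : ℝ))⁻¹ : ℝ) : ℂ) * I)))
        (md i) (a i)‖ ≤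
      (∑ j ∈ Finset.range J, (1 / 2 : ℝ) ^ j *
          Real.sqrt (∑ q ∈ Q, ‖g q * ((((((q : ℝ))⁻¹ - t₀) / ℓ) ^ j : ℝ) : ℂ)‖ ^ 2)) *
        (Real.sqrt (∑ h ∈ Finset.Icc 1 H, ∑ c' ∈ (Finset.range h).filter (fun c' ↦ c'.Coprime h),
            (∑ i ∈ fam.filter (fun i ↦ md i = h ∧ (a i).val = c'), ‖A i‖) ^ 2) *
          ((1 + Real.log H) * Real.sqrt (2 * ((N₀ : ℝ) + 1) / R + 4 * H))) +
        J * (1 / 2) ^ J * (∑ i ∈ fam, ‖A i‖) * ∑ q ∈ Q, ‖g q‖ := by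
  classical
  -- box points of the members
  have hbox : ∀ i ∈ fam, K₁ i * τ₁ ∈ Set.Icc (K₁ i / 2) (2 * K₁ i) ∧ K₂ i * τ₂ ∈ Set.Icc (K₂ i / 2) (2 * K₂ i) := by
    intro i hi
    have h1 := hK₁ i hi; have h2 := hK₂ i hi
    refine ⟨⟨?_, ?_⟩, ⟨?_, ?_⟩⟩ <;> nlinarith [hτ₁.1, hτ₁.2, hτ₂.1, hτ₂.2]
  -- per member: Taylor separation inside its `levelLargePart`
  set Cf : ι → ℕ → ℂ := fun i j ↦ ((ℓ ^ j / j ! : ℝ) : ℂ) * iteratedDeriv j (fun v : ℝ =>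
      (cutoffW ((4 * π ^ 2 * ((d₁ i : ℝ) * (K₁ i * τ₁) * ((d₂ i : ℝ) * (K₂ i * τ₂)))) * v) : ℂ) *
        (besselJ 1 ((4 * π * Real.sqrt ((α i : ℝ) * (K₁ i * τ₁) * ((β i : ℝ) * (K₂ i * τ₂))) / c i) * v) : ℂ) *
          Complex.exp (((-2 * π * ((K₁ i * τ₁) * X₁ i + (K₂ i * τ₂) * X₂ i) * v : ℝ) : ℂ) * I)) t₀ with hCf
  set L : ι → ℂ := fun i ↦ levelLargePart R Q (fun q ↦ g q *
      ((cutoffW ((4 * π ^ 2 * ((d₁ i : ℝ) * (K₁ i * τ₁) * ((d₂ i : ℝ) * (K₂ i * τ₂)))) * ((q : ℝ))⁻¹) : ℂ) *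
        (besselJ 1 ((4 * π * Real.sqrt ((α i : ℝ) * (K₁ i * τ₁) * ((β i : ℝ) * (K₂ i * τ₂))) / c i) * ((q : ℝ))⁻¹) : ℂ) *
          Complex.exp (((-2 * π * ((K₁ i * τ₁) * X₁ i + (K₂ i * τ₂) * X₂ i) * ((q : ℝ))⁻¹ : ℝ) : ℂ) * I)))
      (md i) (a i) with hL
  set P : ℕ → ι → ℂ := fun j i ↦ levelLargePart R Q (fun q ↦ g q * ((((((q : ℝ))⁻¹ - t₀) / ℓ) ^ j : ℝ) : ℂ))
      (md i) (a i) with hP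
  have htaylor : ∀ i ∈ fam, ‖L i - ∑ j ∈ Finset.range J, Cf i j * P j i‖ ≤ J * (1 / 2) ^ J * ∑ q ∈ Q, ‖g q‖ ∧
      ∀ j : ℕ, ‖Cf i j‖ ≤ (1 / 2) ^ j := by
    intro i hi
    exact levelLargePart_levelFactor_taylor (hd₁ i hi) (hd₂ i hi) (α i) (β i) (c i) (hK₁ i hi) (hK₂ i hi)
      (X₁ i) (X₂ i) hv₀ hℓ ht₀ ht₁ (hℓρ i hi) hJ (hbox i hi).1 (hbox i hi).2 R Q hQt g (a i)
  -- split the family sum: main separated part + remainders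
  have hsplit : ∑ i ∈ fam, A i * L i =
      ∑ j ∈ Finset.range J, ∑ i ∈ fam, (A i * Cf i j) * P j i + ∑ i ∈ fam, A i * (L i - ∑ j ∈ Finset.range J, Cf i j * P j i) := by
    rw [Finset.sum_comm, ← Finset.sum_add_distrib]
    refine Finset.sum_congr rfl fun i _ ↦ ?_
    rw [mul_sub, Finset.mul_sum]
    have : ∑ j ∈ Finset.range J, A i * (Cf i j * P j i) = ∑ j ∈ Finset.range J, A i * Cf i j * P j i :=
      Finset.sum_congr rfl fun j _ ↦ by ring
    rw [this]; ring
  -- the remainders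
  have hrem : ‖∑ i ∈ fam, A i * (L i - ∑ j ∈ Finset.range J, Cf i j * P j i)‖ ≤
      J * (1 / 2) ^ J * (∑ i ∈ fam, ‖A i‖) * ∑ q ∈ Q, ‖g q‖ := by
    calc _ ≤ ∑ i ∈ fam, ‖A i‖ * (J * (1 / 2) ^ J * ∑ q ∈ Q, ‖g q‖) := by
          refine norm_sum_le_of_le _ fun i hi ↦ ?_
          rw [norm_mul]
          exact mul_le_mul_of_nonneg_left (htaylor i hi).1 (norm_nonneg _)
      _ = _ := by rw [← Finset.sum_mul]; ring
  -- the separated parts: aggregate large sieve for each `j`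
  have hmain : ∀ j ∈ Finset.range J, ‖∑ i ∈ fam, (A i * Cf i j) * P j i‖ ≤
      (1 / 2 : ℝ) ^ j * Real.sqrt (∑ q ∈ Q, ‖g q * ((((((q : ℝ))⁻¹ - t₀) / ℓ) ^ j : ℝ) : ℂ)‖ ^ 2) *
        (Real.sqrt (∑ h ∈ Finset.Icc 1 H, ∑ c' ∈ (Finset.range h).filter (fun c' ↦ c'.Coprime h),
            (∑ i ∈ fam.filter (fun i ↦ md i = h ∧ (a i).val = c'), ‖A i‖) ^ 2) *
          ((1 + Real.log H) * Real.sqrt (2 * ((N₀ : ℝ) + 1) / R + 4 * H))) := by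
    intro j _
    have hls := norm_sum_mul_levelLargePart_le_aggregate_zmod_of_subset_primes Q
      (fun q ↦ g q * ((((((q : ℝ))⁻¹ - t₀) / ℓ) ^ j : ℝ) : ℂ)) hR hQ hH fam md a (fun i ↦ A i * Cf i j) hI
    have hfib := sqrt_sum_fiber_mul_le fam md (fun i ↦ (a i).val) A (fun i ↦ Cf i j) (by positivity : (0 : ℝ) ≤ (1 / 2) ^ j)
      (fun i hi ↦ (htaylor i hi).2 j) H
    refine hls.trans ?_
    have h0 : 0 ≤ (1 + Real.log H) * Real.sqrt (2 * ((N₀ : ℝ) + 1) / R + 4 * H) *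
        Real.sqrt (∑ q ∈ Q, ‖g q * ((((((q : ℝ))⁻¹ - t₀) / ℓ) ^ j : ℝ) : ℂ)‖ ^ 2) := by
      have := Real.log_natCast_nonneg H; positivity
    calc _ ≤ ((1 / 2 : ℝ) ^ j * Real.sqrt (∑ h ∈ Finset.Icc 1 H, ∑ c' ∈ (Finset.range h).filter (fun c' ↦ c'.Coprime h),
            (∑ i ∈ fam.filter (fun i ↦ md i = h ∧ (a i).val = c'), ‖A i‖) ^ 2)) *
          ((1 + Real.log H) * Real.sqrt (2 * ((N₀ : ℝ) + 1) / R + 4 * H) *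
            Real.sqrt (∑ q ∈ Q, ‖g q * ((((((q : ℝ))⁻¹ - t₀) / ℓ) ^ j : ℝ) : ℂ)‖ ^ 2)) :=
          mul_le_mul_of_nonneg_right hfib h0
      _ = _ := by ring
  -- assemble
  rw [hsplit]
  refine (norm_add_le _ _).trans (add_le_add ?_ hrem)
  refine (norm_sum_le _ _).trans ?_
  rw [Finset.sum_mul]
  refine Finset.sum_le_sum fun j hj ↦ ?_
  refine (hmain j hj).trans (le_of_eq ?_)
  ring

end Summit.Parity.GeneralizedHardyLittlewood.Theorems.BeyondDiagonalBeatsQuarter.OffDiag
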